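import Summits.QuantumFields.YangMills.Theorems.BalabanUVNodesK0RecordFormatNamesLocC

/-!
# K0⁷ — THE RECORD-SIDE FORMAT NAMES, EDITION 16e = CRIT-1 g34's RULING on ◇ lens-1's JOIN-v6 SIZING FINDING S-1 (nodeO STATUS 03:04:50Z; (K-1) radius QUANTIFIED by the cutter,
# (K-2) the no-wrap guard STRUCK from the decay row ONLY): the generic receipt `Response9DLocW₂` and the record's `Response9DLocAt₂ F θ a Mc k K₀ R0 R3 z₀ α₂ C₉ δ₀` (v11-Loc's (C1) by name)

DEFINER seat `ym-nodeO-def-1` (gen 34); `--kind definition --supports stmt-QuantumFields-20541 --as helper`; count-neutral.  [I] = [Balaban1987RG1], [15] = [Balaban1985Variational].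

WHY (CRIT-1, verbatim in substance).  (K-2) `Response9DLocW` (ed.16c) guards its decay row (R1ᴰ-Loc) by `nowrap n`; but decay INSIDE a window is TRUE-shaped in every member WITHOUT it (a
distance-cube never self-overlaps partially — full circle or interval per direction; box distance ≥ torus distance; images ∕ [13] ∕ the torus problem when `2R0+1 ≥ N`), whereas `NoWrapAt` is a
CENTRING condition needed for TRANSPORT only — so as signed (v10-Loc) the decay row was VOID on the seam slab of every member and for every torus-sized window: a hole the JOIN cannot fill.
Cure: strike `nowrap n →` from (R1ᴰ-Loc) ONLY; keep `nowrap n → nowrap (n+1) →` on (R4ᴰ-Loc).  (K-1) the window radius is QUANTIFIED by the cutter (`∀ R3, nestRadius Mc 3 ≤ R3 →`, window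
radius `R3 + nestRadius Mc 1`, constants uniform) — an instance FAMILY of print's generic theorem ([15] Prop. 9 for generic sequences {Ω_j}); no new name needed for that: `Response9DLocAt₂`
takes `R0 R3` as ed.16c's receipt does.

WHAT THIS FILE IS (definitions only, append-only twins of ed.16c §24h): `Response9DLocW₂ R χ N D inner nowrap C₉ δ₀` (= `Response9DLocW` with (R1ᴰ-Loc) `∀ n X y, (∀ i ∈ cX n X,
inner n (siteOf n i)) → …` — NO `nowrap n` there; (R4ᴰ-Loc) `X ∉ wrap n → nowrap n → nowrap (n+1) → …` KEPT; (R0)(R3)(R5) verbatim) and `Response9DLocAt₂ F θ a Mc k K₀ R0 R3 z₀ α₂ C₉ δ₀ :=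
Response9DLocW₂ (recordResponse9DataFromLocAtξ … R0 z₀) charts radii dom44 (fun n l => l.2 ∈ recordWindow F k (K₀+n) R3 z₀) (fun n => NoWrapAt F k (K₀+n) R0 z₀) C₉ δ₀`.  Faces (projections,
`Response9DLocW₂ → Response9DLocW`, `Response9D ∕ Response9DLoc → Response9DLocW₂`, the nest bridge) in lemma file 12.

HONEST FRAMING.  Definitions only; NOTHING of Bałaban is asserted, ported or discharged; 27931 «OPEN · SIGNED v10-Loc · SUPERSEDED-PENDING (v11-Loc spec'd over THESE names)»; 27930⁸∕26648
SIGNED·OPEN; K0⁷∕K-Ax OPEN; NODE O 0∕1; COUNT 8∕28 · K 1∕4 UNMOVED; finite `𝕋⁴_{L^K}` at fixed ε — NOT continuum ∕ ℝ⁴ ∕ OS; **the Yang–Mills mass gap (Clay) is NOT proved by any of this.**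
No `sorry`, `instance`, `notation`; standard axioms.
-/

noncomputable section

open scoped BigOperators Matrix.Norms.L2Operator

namespace Summit.QuantumFields.YangMills.Theorems.K0RecordFormatNames

open Literature.MathematicalPhysics.QuantumFieldTheory.Balaban1983to89
open Literature.MathematicalPhysics.QuantumFieldTheory.Balaban1983to89.Node00
open Literature.MathematicalPhysics.QuantumFieldTheory.Balaban1983to89.T4Continuum (T4Family)
open Literature.MathematicalPhysics.QuantumFieldTheory.Balaban1983to89.B12FormatPlus (cutTo restrictCLM)

variable (F : T4Family)

/-- ★ **`Response9DLocW₂` — `Response9DLocW` WITH THE NO-WRAP GUARD STRUCK FROM THE DECAY ROW ONLY** (CRIT-1 on lens-1 S-1 (K-2), 03:04:50Z): (R0) constants; **(R1ᴰ-Loc)**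
`∀ n X y, (∀ i ∈ cX n X, inner n (siteOf n i)) → gauge (D n X) (cutTo (cX n X) (Gk n y)) ≤ C₉·e^{−δ₀·dist(y, X)}` — in EVERY member (decay inside a window is true-shaped without centring);
(R3) unwrap compatibility VERBATIM; **(R4ᴰ-Loc)** the two-volume comparison under `X ∉ wrap n → nowrap n → nowrap (n+1) →` (centring IS needed for transport) VERBATIM; (R5) chart intertwining
VERBATIM.  Generic; hypothesis form; asserts nothing. [cite: Balaban1985Variational, Prop. 9 p.309, (190) p.308; Balaban1987RG1, (4.4)–(4.5) pp.281–282, p.274 L9–13, (1.21) p.264, (4.35) p.290] -/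
def Response9DLocW₂ {S : ℕ → LocDomainSys} {M m : ℕ → ℕ} {d : ℕ} (R : B12FormatPlus.Response9Data S M m d)
    (χ : (n : ℕ) → (S n).Dom → (Fin (m n) → ℂ) → (Fin (M n) → ℂ)) (N : ℕ → ℕ) (D : (n : ℕ) → (S n).Dom → Set (Fin (m n) → ℂ))
    (inner : (n : ℕ) → R.Λ n → Prop) (nowrap : ℕ → Prop) (C₉ δ₀ : ℝ) : Prop :=
  0 ≤ C₉ ∧ 0 ≤ δ₀ ∧
  (∀ n X y, (∀ i ∈ R.cX n X, inner n (R.siteOf n i)) →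
    gauge (D n X) (cutTo (R.cX n X) (R.Gk n y)) ≤ C₉ * Real.exp (-δ₀ * (R.G n).distD y X)) ∧
  (∀ n X, X ∉ R.wrap n → ∀ i ∈ R.cX n X, R.jX n X i ∈ R.cX (n + 1) (R.emb n X)) ∧
  (∀ n X, X ∉ R.wrap n → nowrap n → nowrap (n + 1) → ∀ (μ : Fin d) (z : Fin d → ℤ), (∀ l, 2 * |z l| < (N n : ℤ)) →
    gauge (D n X) (cutTo (R.cX n X) fun i => R.Gk (n + 1) (R.e (n + 1) μ z) (R.jX n X i) - R.Gk n (R.e n μ z) i) ≤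
      C₉ * Real.exp (-δ₀ * (N n : ℝ) / 2) * Real.exp (-(δ₀ / 2) * (R.G n).distD (R.e n μ z) X)) ∧
  (∀ n X, X ∉ R.wrap n → ∀ w', R.πc n X (χ (n + 1) (R.emb n X) w') = χ n X (restrictCLM (R.cX n X) (R.jX n X) w'))

section Theta

variable (θ : Stage13Params F 2)

/-- ★ **RECEIPT `Response9DLocAt₂ F θ a Mc k K₀ R0 R3 z₀ α₂ C₉ δ₀`** — v11-Loc's (C1) by name: `Response9DLocW₂` for the chart-unit localized data at `(R0, z₀)` in the gauge norm of the
two-block (4.4) domain, CENTRED layer, radius `recordRNat`, base volume `K₀`, inner guard «the label over each chart input of `X` lies in the cube of radius `R3` about `z₀`», per-member centring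
guard `NoWrapAt … (K₀+n) R0 z₀` on the two-volume row ONLY (instance: □₀-localized DOMAIN problem [B6] (2.5)–(2.6), Ω₀ = T, A pinned on Λ₀ = □₀ᶜ; flat background U₀ = 1 (K7-c); linear
order; chart units).  The cutter binds `∀ R3, nestRadius Mc 3 ≤ R3 →` and takes `R0 := R3 + nestRadius Mc 1`, constants outside.  Prop-valued; asserts nothing.
[cite: Balaban1985Variational, Prop. 9 p.309; Balaban1987RG1, (4.4) p.281, (4.35) p.290, (3.37) p.277, p.290 L25–30, (1.21) p.264] -/
def Response9DLocAt₂ (a : θ.ιβ) (Mc k K₀ R0 R3 : ℕ) (z₀ : Fin 4 → ℤ) (α₂ C₉ δ₀ : ℝ) : Prop :=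
  Response9DLocW₂ (recordResponse9DataFromLocAtξ F θ a Mc k K₀ R0 z₀) (fun n => recordChartJ F Mc k (K₀ + n)) (fun n => recordRNat F Mc k (K₀ + n))
    (fun n X => recordDom44J F Mc k (K₀ + n) X α₂) (fun n l => l.2 ∈ recordWindow F k (K₀ + n) R3 z₀) (fun n => NoWrapAt F k (K₀ + n) R0 z₀) C₉ δ₀

end Theta

end Summit.QuantumFields.YangMills.Theorems.K0RecordFormatNames

end
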